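import Mathlib
import Summits.NavierStokesRegularity.NavierStokesRegularity.Theorems.FilamentSkeletonRssStadiumDeviationRatio

/-!
# The `1/n`-disc deviation package BELOW the real line (`TangentSkeletonNearStraightL`, stmt-NavierStokesRegularity-23320, registered stub
# `stub_stripPropagation`) — reflection through the real foot

Theorems.StadiumTangentDeviation / StadiumDeviationRatio bound `F′(x+it) − F′(x)` for `t ≥ 0`.  The point reflection `w ↦ 2x − w` through the
real foot `x` is HOLOMORPHIC (affine), maps `x + iu` to `x − iu`, preserves `‖F′‖`, realness on the real axis and the shrinking Cauchy discs; applied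
to `F ∘ (2x − ·)` it yields the same bounds for `t ≤ 0`, hence for `|t|` (`deviation_ratio_abs`, `euclid_im_le_abs`, `euclid_re_dev_le_abs`):
if `n·|t| < hs` and `|x − cc| + n·|t| < L + hs` then `‖F′(x+it) − F′(x)‖ ≤ M·log(n/(n−1))`, `|Re F′ᵢ(x+it) − Re F′ᵢ(x)| ≤ 2M(log(n/(n−1)) − 1/n)`,
and the Euclidean forms.  This removes the upper-half-plane restriction from Theorems.StadiumContourPositivity / StadiumOwnFarSharp for the next
hand (same proofs with these inputs).  HONEST FRAMING: a tool for a HYPOTHETICAL filament skeleton on the NEGATIVE side of a MODEL route; nothing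
here bears on Navier–Stokes regularity or blow-up.  `--supports stmt-NavierStokesRegularity-23320`.
-/

set_option linter.dupNamespace false

noncomputable section

namespace Summit.NavierStokesRegularity.NavierStokesRegularity.Theorems.StadiumDeviationReflect

open Set Metric
open scoped InnerProductSpace
open Summit.NavierStokesRegularity.NavierStokesRegularity.Theorems.StadiumTangentDeviation
open Summit.NavierStokesRegularity.NavierStokesRegularity.Theorems.StadiumDeviationPackage
open Summit.NavierStokesRegularity.NavierStokesRegularity.Theorems.StadiumDeviationRatio

/-- The reflected stadium through the real point `x`: `{w | 2x − w ∈ S}` is again a rectangle stadium (centre `2x − cc`). [folklore] -/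
theorem reflect_mem_iff {hs L cc x : ℝ} (w : ℂ) :
    (2 * (x : ℂ) - w) ∈ {z : ℂ | |z.im| < hs ∧ |z.re - cc| < L + hs} ↔
      w ∈ {z : ℂ | |z.im| < hs ∧ |z.re - (2 * x - cc)| < L + hs} := by
  simp only [mem_setOf_eq, Complex.sub_im, Complex.sub_re, Complex.mul_im, Complex.mul_re, Complex.ofReal_re,
    Complex.ofReal_im, Complex.re_ofNat, Complex.im_ofNat, mul_zero, zero_mul, sub_zero, add_zero, zero_sub, abs_neg]
  constructor
  · rintro ⟨h1, h2⟩; refine ⟨h1, ?_⟩; rw [show w.re - (2 * x - cc) = -(2 * x - w.re - cc) by ring, abs_neg]; exact h2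
  · rintro ⟨h1, h2⟩; refine ⟨h1, ?_⟩; rw [show 2 * x - w.re - cc = -(w.re - (2 * x - cc)) by ring, abs_neg]; exact h2

/-- **Deviation bounds for `t ≤ 0`** by reflection through the foot. [folklore] -/
theorem deviation_ratio_nonpos {hs L cc M : ℝ} {F : ℂ → (Fin 3 → ℂ)}
    (hF : DifferentiableOn ℂ F {z : ℂ | |z.im| < hs ∧ |z.re - cc| < L + hs})
    (hM : ∀ z ∈ {z : ℂ | |z.im| < hs ∧ |z.re - cc| < L + hs}, ‖deriv F z‖ ≤ M)
    {X : ℝ → EuclideanSpace ℝ (Fin 3)}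
    (hFX : ∀ r : ℝ, (r : ℂ) ∈ {z : ℂ | |z.im| < hs ∧ |z.re - cc| < L + hs} →
      F r = fun i => ((⟪X r, EuclideanSpace.single i (1:ℝ)⟫_ℝ : ℝ) : ℂ))
    {n x t : ℝ} (hn : 1 < n) (ht : t ≤ 0) (hfit : n * |t| < hs) (hfit' : |x - cc| + n * |t| < L + hs) (hhs : 0 < hs)
    (hx : |x - cc| < L + hs) (i : Fin 3) :
    ‖deriv F ((x : ℂ) + (t : ℂ) * Complex.I) - deriv F (x : ℂ)‖ ≤ M * Real.log (n / (n - 1)) ∧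
    |(deriv F ((x : ℂ) + (t : ℂ) * Complex.I) i).re - (deriv F (x : ℂ) i).re| ≤ 2 * M * (Real.log (n / (n - 1)) - 1 / n) := by
  -- the reflected function and stadium
  set S : Set ℂ := {z : ℂ | |z.im| < hs ∧ |z.re - cc| < L + hs} with hS
  set S' : Set ℂ := {z : ℂ | |z.im| < hs ∧ |z.re - (2 * x - cc)| < L + hs} with hS'
  set ρ : ℂ → ℂ := fun w => 2 * (x : ℂ) - w with hρ
  set F' : ℂ → (Fin 3 → ℂ) := fun w => F (ρ w) with hF'
  have hρS : ∀ w, w ∈ S' ↔ ρ w ∈ S := fun w => (reflect_mem_iff w).symm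
  have hρd : ∀ w, HasDerivAt ρ (-1) w := by
    intro w
    have h := ((hasDerivAt_id w).const_sub (2 * (x : ℂ)))
    simpa [hρ] using h
  have hF'd : DifferentiableOn ℂ F' S' := by
    intro w hw
    have h1 : DifferentiableAt ℂ F (ρ w) := hF.differentiableAt ((by
      have h1 : IsOpen S := by
        have a1 : IsOpen {z : ℂ | |z.im| < hs} := isOpen_lt (continuous_abs.comp Complex.continuous_im) continuous_const
        have a2 : IsOpen {z : ℂ | |z.re - cc| < L + hs} :=
          isOpen_lt (continuous_abs.comp (Complex.continuous_re.sub continuous_const)) continuous_const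
        exact a1.inter a2
      exact h1.mem_nhds ((hρS w).1 hw)))
    exact (h1.comp w (hρd w).differentiableAt).differentiableWithinAt
  -- derivative of the reflected function
  have hderiv : ∀ w, ρ w ∈ S → deriv F' w = -deriv F (ρ w) := by
    intro w hw
    have hSo : IsOpen S := by
      have a1 : IsOpen {z : ℂ | |z.im| < hs} := isOpen_lt (continuous_abs.comp Complex.continuous_im) continuous_const
      have a2 : IsOpen {z : ℂ | |z.re - cc| < L + hs} :=
        isOpen_lt (continuous_abs.comp (Complex.continuous_re.sub continuous_const)) continuous_const
      exact a1.inter a2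
    have h1 : HasDerivAt F (deriv F (ρ w)) (ρ w) := (hF.differentiableAt (hSo.mem_nhds hw)).hasDerivAt
    have h2 := h1.scomp w (hρd w)
    have h3 : deriv F' w = ((-1 : ℂ) • deriv F (ρ w)) := h2.deriv
    rw [h3, neg_one_smul]
  have hM' : ∀ w ∈ S', ‖deriv F' w‖ ≤ M := by
    intro w hw
    rw [hderiv w ((hρS w).1 hw), norm_neg]
    exact hM _ ((hρS w).1 hw)
  -- realness on the real trace: `F'(r) = cplx (X (2x − r))`
  have hFX' : ∀ r : ℝ, (r : ℂ) ∈ S' → F' r = fun i => ((⟪(fun s => X (2 * x - s)) r, EuclideanSpace.single i (1:ℝ)⟫_ℝ : ℝ) : ℂ) := by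
    intro r hr
    have h1 : ρ r = (((2 * x - r : ℝ)) : ℂ) := by simp [hρ]; 
    have h2 : (((2 * x - r : ℝ)) : ℂ) ∈ S := by rw [← h1]; exact (hρS r).1 hr
    show F (ρ r) = _
    rw [h1, hFX _ h2]
  -- apply the upper-half lemma to `F'` at height `−t ≥ 0`
  have hx' : |x - (2 * x - cc)| < L + hs := by rw [show x - (2 * x - cc) = -(x - cc) by ring, abs_neg]; exact hx
  have habs : |t| = -t := abs_of_nonpos ht
  have hfit1 : n * (-t) < hs := by rw [← habs]; exact hfit
  have hfit1' : |x - (2 * x - cc)| + n * (-t) < L + hs := by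
    rw [show x - (2 * x - cc) = -(x - cc) by ring, abs_neg, ← habs]; exact hfit'
  have h := deviation_ratio hF'd hM' hFX' hn (by linarith : 0 ≤ -t) hfit1 hfit1' hhs hx' i
  -- translate back: `F'(x + i(−t)) = F(x + it)`, `deriv F' = −deriv F ∘ ρ`
  have hρ1 : ρ ((x : ℂ) + ((-t : ℝ) : ℂ) * Complex.I) = (x : ℂ) + (t : ℂ) * Complex.I := by
    simp [hρ]; ring
  have hρ2 : ρ (x : ℂ) = (x : ℂ) := by simp [hρ]; ring
  have hxS : (x : ℂ) ∈ S := ⟨by simpa using hhs, by simpa using hx⟩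
  have hztS : (x : ℂ) + (t : ℂ) * Complex.I ∈ S := by
    refine ⟨?_, by simpa using hx⟩
    have : (((x : ℂ) + (t : ℂ) * Complex.I).im) = t := by simp
    rw [this]
    have hn1 : |t| ≤ n * |t| := by nlinarith [abs_nonneg t]
    linarith
  have hd1 : deriv F' ((x : ℂ) + ((-t : ℝ) : ℂ) * Complex.I) = -deriv F ((x : ℂ) + (t : ℂ) * Complex.I) := by
    rw [hderiv _ (by rw [hρ1]; exact hztS), hρ1]
  have hd2 : deriv F' (x : ℂ) = -deriv F (x : ℂ) := by
    rw [hderiv _ (by rw [hρ2]; exact hxS), hρ2]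
  rw [hd1, hd2] at h
  refine ⟨?_, ?_⟩
  · have e : -deriv F ((x : ℂ) + (t : ℂ) * Complex.I) - -deriv F (x : ℂ) =
        -(deriv F ((x : ℂ) + (t : ℂ) * Complex.I) - deriv F (x : ℂ)) := by abel
    rw [e, norm_neg] at h
    exact h.1
  · have h2 := h.2
    simp only [Pi.neg_apply, Complex.neg_re] at h2
    rw [show -(deriv F ((x : ℂ) + (t : ℂ) * Complex.I) i).re - -(deriv F (x : ℂ) i).re =
      -((deriv F ((x : ℂ) + (t : ℂ) * Complex.I) i).re - (deriv F (x : ℂ) i).re) by ring, abs_neg] at h2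
    exact h2

/-- **Deviation bounds for any sign of `t`** (`n·|t|`-discs). [folklore] -/
theorem deviation_ratio_abs {hs L cc M : ℝ} {F : ℂ → (Fin 3 → ℂ)}
    (hF : DifferentiableOn ℂ F {z : ℂ | |z.im| < hs ∧ |z.re - cc| < L + hs})
    (hM : ∀ z ∈ {z : ℂ | |z.im| < hs ∧ |z.re - cc| < L + hs}, ‖deriv F z‖ ≤ M)
    {X : ℝ → EuclideanSpace ℝ (Fin 3)}
    (hFX : ∀ r : ℝ, (r : ℂ) ∈ {z : ℂ | |z.im| < hs ∧ |z.re - cc| < L + hs} →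
      F r = fun i => ((⟪X r, EuclideanSpace.single i (1:ℝ)⟫_ℝ : ℝ) : ℂ))
    {n x t : ℝ} (hn : 1 < n) (hfit : n * |t| < hs) (hfit' : |x - cc| + n * |t| < L + hs) (hhs : 0 < hs)
    (hx : |x - cc| < L + hs) (i : Fin 3) :
    ‖deriv F ((x : ℂ) + (t : ℂ) * Complex.I) - deriv F (x : ℂ)‖ ≤ M * Real.log (n / (n - 1)) ∧
    |(deriv F ((x : ℂ) + (t : ℂ) * Complex.I) i).re - (deriv F (x : ℂ) i).re| ≤ 2 * M * (Real.log (n / (n - 1)) - 1 / n) := by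
  rcases le_total 0 t with ht | ht
  · rw [abs_of_nonneg ht] at hfit hfit'
    exact deviation_ratio hF hM hFX hn ht hfit hfit' hhs hx i
  · exact deviation_ratio_nonpos hF hM hFX hn ht hfit hfit' hhs hx i

/-- **Euclidean imaginary deviation, any sign.** [folklore] -/
theorem euclid_im_le_abs {hs L cc M : ℝ} {F : ℂ → (Fin 3 → ℂ)}
    (hF : DifferentiableOn ℂ F {z : ℂ | |z.im| < hs ∧ |z.re - cc| < L + hs})
    (hM : ∀ z ∈ {z : ℂ | |z.im| < hs ∧ |z.re - cc| < L + hs}, ‖deriv F z‖ ≤ M)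
    {X : ℝ → EuclideanSpace ℝ (Fin 3)} (hX : Differentiable ℝ X)
    (hFX : ∀ r : ℝ, (r : ℂ) ∈ {z : ℂ | |z.im| < hs ∧ |z.re - cc| < L + hs} →
      F r = fun i => ((⟪X r, EuclideanSpace.single i (1:ℝ)⟫_ℝ : ℝ) : ℂ))
    {n x t : ℝ} (hn : 1 < n) (hfit : n * |t| < hs) (hfit' : |x - cc| + n * |t| < L + hs) (hhs : 0 < hs)
    (hx : |x - cc| < L + hs) :
    √(∑ i, (deriv F ((x : ℂ) + (t : ℂ) * Complex.I) i).im ^ 2) ≤ √3 * (M * Real.log (n / (n - 1))) := by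
  have hcomp : ∀ i, |(deriv F ((x : ℂ) + (t : ℂ) * Complex.I) i).im| ≤ M * Real.log (n / (n - 1)) := by
    intro i
    have h1 := (deviation_ratio_abs hF hM hFX hn hfit hfit' hhs hx i).1
    have h0 := (deriv_real_point hF hX hFX hhs hx i).2
    have e : (deriv F ((x : ℂ) + (t : ℂ) * Complex.I) i).im =
        ((deriv F ((x : ℂ) + (t : ℂ) * Complex.I) - deriv F (x : ℂ)) i).im := by
      simp [Pi.sub_apply, Complex.sub_im, h0]
    rw [e]
    exact ((Complex.abs_im_le_norm _).trans (norm_le_pi_norm _ i)).trans h1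
  have hM0 : 0 ≤ M * Real.log (n / (n - 1)) := (abs_nonneg _).trans (hcomp 0)
  have hsum : ∑ i, (deriv F ((x : ℂ) + (t : ℂ) * Complex.I) i).im ^ 2 ≤ 3 * (M * Real.log (n / (n - 1))) ^ 2 :=
    calc ∑ i, (deriv F ((x : ℂ) + (t : ℂ) * Complex.I) i).im ^ 2 ≤ ∑ _i : Fin 3, (M * Real.log (n / (n - 1))) ^ 2 :=
          Finset.sum_le_sum fun i _ => sq_le_sq' (by linarith [neg_abs_le ((deriv F ((x : ℂ) + (t : ℂ) * Complex.I) i).im), hcomp i])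
            ((le_abs_self _).trans (hcomp i))
      _ = 3 * (M * Real.log (n / (n - 1))) ^ 2 := by simp
  calc √(∑ i, (deriv F ((x : ℂ) + (t : ℂ) * Complex.I) i).im ^ 2) ≤ √(3 * (M * Real.log (n / (n - 1))) ^ 2) :=
        Real.sqrt_le_sqrt hsum
    _ = √3 * (M * Real.log (n / (n - 1))) := by rw [Real.sqrt_mul (by norm_num), Real.sqrt_sq hM0]

/-- **Euclidean real-part deviation from the real tangent, any sign.** [folklore] -/
theorem euclid_re_dev_le_abs {hs L cc M : ℝ} {F : ℂ → (Fin 3 → ℂ)}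
    (hF : DifferentiableOn ℂ F {z : ℂ | |z.im| < hs ∧ |z.re - cc| < L + hs})
    (hM : ∀ z ∈ {z : ℂ | |z.im| < hs ∧ |z.re - cc| < L + hs}, ‖deriv F z‖ ≤ M)
    {X : ℝ → EuclideanSpace ℝ (Fin 3)} (hX : Differentiable ℝ X)
    (hFX : ∀ r : ℝ, (r : ℂ) ∈ {z : ℂ | |z.im| < hs ∧ |z.re - cc| < L + hs} →
      F r = fun i => ((⟪X r, EuclideanSpace.single i (1:ℝ)⟫_ℝ : ℝ) : ℂ))
    {n x t : ℝ} (hn : 1 < n) (hfit : n * |t| < hs) (hfit' : |x - cc| + n * |t| < L + hs) (hhs : 0 < hs)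
    (hx : |x - cc| < L + hs) :
    √(∑ i, ((deriv F ((x : ℂ) + (t : ℂ) * Complex.I) i).re - ⟪deriv X x, EuclideanSpace.single i (1:ℝ)⟫_ℝ) ^ 2) ≤
      √3 * (2 * M * (Real.log (n / (n - 1)) - 1 / n)) := by
  have hcomp : ∀ i, |(deriv F ((x : ℂ) + (t : ℂ) * Complex.I) i).re - ⟪deriv X x, EuclideanSpace.single i (1:ℝ)⟫_ℝ| ≤
      2 * M * (Real.log (n / (n - 1)) - 1 / n) := by
    intro i
    have h1 := (deviation_ratio_abs hF hM hFX hn hfit hfit' hhs hx i).2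
    have h0 := (deriv_real_point hF hX hFX hhs hx i).1
    rw [← h0]; exact h1
  have hM0 : 0 ≤ 2 * M * (Real.log (n / (n - 1)) - 1 / n) := (abs_nonneg _).trans (hcomp 0)
  have hsum : ∑ i, ((deriv F ((x : ℂ) + (t : ℂ) * Complex.I) i).re - ⟪deriv X x, EuclideanSpace.single i (1:ℝ)⟫_ℝ) ^ 2 ≤
      3 * (2 * M * (Real.log (n / (n - 1)) - 1 / n)) ^ 2 :=
    calc ∑ i, ((deriv F ((x : ℂ) + (t : ℂ) * Complex.I) i).re - ⟪deriv X x, EuclideanSpace.single i (1:ℝ)⟫_ℝ) ^ 2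
          ≤ ∑ _i : Fin 3, (2 * M * (Real.log (n / (n - 1)) - 1 / n)) ^ 2 :=
          Finset.sum_le_sum fun i _ => sq_le_sq'
            (by linarith [neg_abs_le ((deriv F ((x : ℂ) + (t : ℂ) * Complex.I) i).re -
              ⟪deriv X x, EuclideanSpace.single i (1:ℝ)⟫_ℝ), hcomp i])
            ((le_abs_self _).trans (hcomp i))
      _ = 3 * (2 * M * (Real.log (n / (n - 1)) - 1 / n)) ^ 2 := by simp
  calc √(∑ i, ((deriv F ((x : ℂ) + (t : ℂ) * Complex.I) i).re - ⟪deriv X x, EuclideanSpace.single i (1:ℝ)⟫_ℝ) ^ 2)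
        ≤ √(3 * (2 * M * (Real.log (n / (n - 1)) - 1 / n)) ^ 2) := Real.sqrt_le_sqrt hsum
    _ = √3 * (2 * M * (Real.log (n / (n - 1)) - 1 / n)) := by rw [Real.sqrt_mul (by norm_num), Real.sqrt_sq hM0]

end Summit.NavierStokesRegularity.NavierStokesRegularity.Theorems.StadiumDeviationReflect

end
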